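import Literature.Combinatorics.StablePolynomials.SchurMaloSzego
import Mathlib.Algebra.Polynomial.Derivative
import HarnessLib

/-!
# Falling-factorial (Jensen) multipliers preserve stability (Borcea–Brändén I, Lemma 5.2, one variable)

J. Borcea, P. Brändén, *The Lee–Yang and Pólya–Schur programs. I. Linear operators preserving stability*,
Invent. Math. 177 (2009) 541–569 (arXiv:0809.0401), §5.1:

> **Lemma 5.2.** Let `β ∈ ℕⁿ`. The linear operators on `ℂ[z_1,…,z_n]` defined by `z^α ↦ J(α,β) z^α` and
> `z^α ↦ (β)_α z^α`, `α ∈ ℕⁿ`, preserve stability.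
>
> *Proof.* … By Theorem 1.1 we need to show that `G_{T_κ}(z,w) = Σ_{α≤κ} binom(κ,α) (β)_α z^α w^{κ-α}` is
> stable for all `κ ∈ ℕⁿ`. However, `G_{T_κ}(z,w) = Π_i [Σ_j j! binom(κ_i,j) binom(β_i,j) z_i^j w_i^{κ_i-j}]`,
> so the lemma amounts to showing that for any `m, n ∈ ℕ` the univariate polynomial
> `g(t) = Σ_{j=0}^n j! binom(n,j) binom(m,j) t^j` is real-rooted (then necessarily with all negative roots).
> To prove this note that `t^{-m} g(t) = S[t^m]|_{t → t^{-1}}`, where `S = (1 + d/dt)^n`. To prove the well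
> known fact that `S` preserves stability it suffices to consider the case `n = 1`. The symbol of `S` is
> `S[(t+w)^m] = (m+t+w)(t+w)^{m-1}`, which is a stable polynomial.

This file proves the one-variable case (`n = 1` variables, `β = m`) of the second operator,
`t^k ↦ (m)_k t^k` (`(m)_k = m(m-1)⋯(m-k+1) = k! binom(m,k)`), following the printed proof: `onePlusD` is
`1 + d/dt`, its symbol is computed and Theorem 1.1 for `n = 1` (tree `boundedDegree_stabilityPreserver_iff`)
makes it a stability preserver (`onePlusD_stable_or_zero`); `(1 + d/dt)^n t^m = Σ_j binom(n,j) (m)_j t^{m-j}`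
(`iterate_onePlusD_X_pow`) is therefore stable, so the reversed polynomial `g` has only real non-positive
zeros (`binomialForm_descFactorial_roots`), and the Schur–Maló–Szegő mechanism of the tree
(`multiplierOp_stable_or_zero`) concludes (`descFactorial_multiplier_stable_or_zero`).

## Contents

* `onePlusD`, `eval_onePlusD_X_add_C_pow_ne_zero` (the symbol `(m+t+w)(t+w)^{m-1}`), `onePlusD_stable_or_zero`.
* `iterate_onePlusD` (`(1+D)^n = Σ binom(n,j) D^j`), `revJensen` (`Σ_j binom(n,j)(m)_j t^{m-j}`),
  `iterate_onePlusD_X_pow`, `revJensen_stable`.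
* `binomialForm_descFactorial_roots` (`g` has only real zeros `≤ 0`), **`descFactorial_multiplier_stable_or_zero`**
  (Lemma 5.2 for one variable).

## References

* [BorceaBranden2009] J. Borcea, P. Brändén, Invent. Math. 177 (2009) 541–569, §5.1 Lemma 5.2 and its proof;
  §1.1 Thm. 1.1.
-/

noncomputable section

open Finset

namespace Literature.Combinatorics.StablePolynomials

/-! ## §1 The operator `1 + d/dt` -/

section OnePlusD

/-- **`S = 1 + d/dt` on `ℂ[t]`.** [cite: BorceaBranden2009, §5.1 proof of Lemma 5.2 ("`S = (1 + d/dt)^n` … it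
suffices to consider the case `n = 1`")] -/
def onePlusD : Polynomial ℂ →ₗ[ℂ] Polynomial ℂ :=
  LinearMap.id + Polynomial.derivative

/-- `S p = p + p'`. [cite: BorceaBranden2009, §5.1 proof of Lemma 5.2] -/
theorem onePlusD_apply (p : Polynomial ℂ) : onePlusD p = p + Polynomial.derivative p :=
  rfl

/-- **The symbol of `S` does not vanish on `ℋ × ℋ`**: `S[(t+w)^m](z) = (m+z+w)(z+w)^{m-1} ≠ 0`.
[cite: BorceaBranden2009, §5.1 proof of Lemma 5.2 ("The symbol of `S` is `S[(t+w)^m] = (m+t+w)(t+w)^{m-1}`,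
which is a stable polynomial")] -/
theorem eval_onePlusD_X_add_C_pow_ne_zero (m : ℕ) {z w : ℂ} (hz : 0 < z.im) (hw : 0 < w.im) :
    (onePlusD ((Polynomial.X + Polynomial.C w) ^ m)).eval z ≠ 0 := by
  rw [onePlusD_apply, Polynomial.derivative_X_add_C_pow]
  simp only [Polynomial.eval_add, Polynomial.eval_mul, Polynomial.eval_C, Polynomial.eval_pow,
    Polynomial.eval_X]
  have hzw : z + w ≠ 0 := fun h => by
    have h' := congrArg Complex.im h
    rw [Complex.add_im, Complex.zero_im] at h'
    linarith
  rcases Nat.eq_zero_or_pos m with rfl | hm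
  · rw [pow_zero, Nat.cast_zero, zero_mul, add_zero]
    exact one_ne_zero
  · have h1 : (z + w) ^ m + (m : ℂ) * (z + w) ^ (m - 1) = (z + w) ^ (m - 1) * (z + w + m) := by
      obtain ⟨k, rfl⟩ := Nat.exists_eq_succ_of_ne_zero hm.ne'
      rw [Nat.succ_sub_one, pow_succ]
      ring
    rw [h1]
    refine mul_ne_zero (pow_ne_zero _ hzw) fun h => ?_
    have h' := congrArg Complex.im h
    rw [Complex.add_im, Complex.add_im, Complex.natCast_im, Complex.zero_im] at h'
    linarith

/-- **`S = 1 + d/dt` preserves stability** ("the well known fact"), via Theorem 1.1 for `n = 1` and the symbol.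
[cite: BorceaBranden2009, §5.1 proof of Lemma 5.2] [cite: BorceaBranden2009, §1.1 Thm. 1.1] -/
theorem onePlusD_stable_or_zero {p : Polynomial ℂ} (hs : ∀ t : ℂ, 0 < t.im → p.eval t ≠ 0) :
    (∀ t : ℂ, 0 < t.im → (onePlusD p).eval t ≠ 0) ∨ onePlusD p = 0 := by
  set κ : ℕ := max 1 p.natDegree with hκ
  have hκ1 : 0 < κ := lt_of_lt_of_le Nat.one_pos (le_max_left _ _)
  have hG : IsUpperHalfPlaneStable (univariateSymbol κ onePlusD) :=
    (isUpperHalfPlaneStable_univariateSymbol_iff κ _).2 fun z w hz hw =>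
      eval_onePlusD_X_add_C_pow_ne_zero κ hz hw
  exact (boundedDegree_stabilityPreserver_iff hκ1 onePlusD).2 (Or.inr hG) p (le_max_right _ _) hs

/-- Iterating `S` keeps "stable or zero". [cite: BorceaBranden2009, §5.1 proof of Lemma 5.2 (`S = (1+d/dt)^n`)] -/
theorem iterate_onePlusD_stable_or_zero (n : ℕ) {p : Polynomial ℂ}
    (hp : (∀ t : ℂ, 0 < t.im → p.eval t ≠ 0) ∨ p = 0) :
    (∀ t : ℂ, 0 < t.im → (onePlusD^[n] p).eval t ≠ 0) ∨ onePlusD^[n] p = 0 := by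
  induction n with
  | zero => exact hp
  | succ n ih =>
    rw [Function.iterate_succ_apply']
    rcases ih with h | h
    · exact onePlusD_stable_or_zero h
    · exact Or.inr (by rw [h, map_zero])

/-- `D^j (p + q) = D^j p + D^j q`. [folklore] -/
private theorem iterate_derivative_add' (p q : Polynomial ℂ) (j : ℕ) :
    Polynomial.derivative^[j] (p + q) = Polynomial.derivative^[j] p + Polynomial.derivative^[j] q := by
  rw [← Module.End.pow_apply, ← Module.End.pow_apply, ← Module.End.pow_apply, map_add]

/-- **`(1 + d/dt)^n = Σ_j binom(n,j) (d/dt)^j`.** [cite: BorceaBranden2009, §5.1 proof of Lemma 5.2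
(`S = (1 + d/dt)^n`)] -/
theorem iterate_onePlusD (n : ℕ) (p : Polynomial ℂ) :
    onePlusD^[n] p = ∑ j ∈ range (n + 1), ((n.choose j : ℕ) : ℂ) • Polynomial.derivative^[j] p := by
  induction n generalizing p with
  | zero =>
    rw [Function.iterate_zero_apply, zero_add, sum_range_one, Nat.choose_zero_right, Nat.cast_one, one_smul,
      Function.iterate_zero_apply]
  | succ n ih =>
    rw [Function.iterate_succ_apply, ih]
    have h1 : ∀ j : ℕ, Polynomial.derivative^[j] (onePlusD p) =
        Polynomial.derivative^[j] p + Polynomial.derivative^[j + 1] p := fun j => by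
      rw [onePlusD_apply, iterate_derivative_add', Function.iterate_succ_apply]
    simp_rw [h1, smul_add, sum_add_distrib]
    rw [sum_range_succ' (fun j => (((n + 1).choose j : ℕ) : ℂ) • Polynomial.derivative^[j] p),
      sum_range_succ' (fun j => ((n.choose j : ℕ) : ℂ) • Polynomial.derivative^[j] p)]
    simp_rw [Nat.choose_succ_succ', Nat.cast_add, add_smul, sum_add_distrib]
    rw [sum_range_succ (fun j => ((n.choose (j + 1) : ℕ) : ℂ) • Polynomial.derivative^[j + 1] p),
      Nat.choose_succ_self, Nat.cast_zero, zero_smul, add_zero, Nat.choose_zero_right, Nat.choose_zero_right]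
    abel

end OnePlusD

/-! ## §2 The reversed Jensen polynomial `Σ_j binom(n,j) (m)_j t^{m-j} = (1 + d/dt)^n t^m` -/

section Reversed

/-- **`h_{n,m}(t) = Σ_{j ≤ n} binom(n,j) (m)_j t^{m-j}`** (`= (1+d/dt)^n t^m`). [cite: BorceaBranden2009, §5.1
proof of Lemma 5.2 ("`t^{-m} g(t) = S[t^m]|_{t→t^{-1}}`")] -/
def revJensen (R : Type*) [CommSemiring R] (n m : ℕ) : Polynomial R :=
  ∑ j ∈ range (n + 1), Polynomial.C (((n.choose j : ℕ) : R) * ((m.descFactorial j : ℕ) : R)) *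
    Polynomial.X ^ (m - j)

/-- Complexification of `h_{n,m}`. [cite: BorceaBranden2009, §5.1] -/
theorem map_revJensen (n m : ℕ) : (revJensen ℝ n m).map (algebraMap ℝ ℂ) = revJensen ℂ n m := by
  rw [revJensen, revJensen, Polynomial.map_sum]
  refine sum_congr rfl fun j _ => ?_
  rw [Polynomial.map_mul, Polynomial.map_C, Polynomial.map_pow, Polynomial.map_X, map_mul, map_natCast,
    map_natCast]

/-- Evaluating `h_{n,m}`. [cite: BorceaBranden2009, §5.1] -/
theorem eval_revJensen {R : Type*} [CommSemiring R] (n m : ℕ) (s : R) :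
    (revJensen R n m).eval s =
      ∑ j ∈ range (n + 1), ((n.choose j : ℕ) : R) * ((m.descFactorial j : ℕ) : R) * s ^ (m - j) := by
  rw [revJensen, Polynomial.eval_finsetSum]
  simp only [Polynomial.eval_mul, Polynomial.eval_C, Polynomial.eval_pow, Polynomial.eval_X]

/-- **`(1 + d/dt)^n t^m = h_{n,m}(t)`.** [cite: BorceaBranden2009, §5.1 proof of Lemma 5.2] -/
theorem iterate_onePlusD_X_pow (n m : ℕ) :
    onePlusD^[n] ((Polynomial.X : Polynomial ℂ) ^ m) = revJensen ℂ n m := by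
  rw [iterate_onePlusD, revJensen]
  refine sum_congr rfl fun j _ => ?_
  rw [Polynomial.iterate_derivative_X_pow_eq_smul, smul_smul, Polynomial.smul_eq_C_mul]

/-- **`h_{n,m}` is stable** (`t^m` is stable and `(1+d/dt)^n` preserves stability; `h_{n,m}(1) ≥ 1` rules out
`0`). [cite: BorceaBranden2009, §5.1 proof of Lemma 5.2] -/
theorem revJensen_stable (n m : ℕ) : ∀ t : ℂ, 0 < t.im → (revJensen ℂ n m).eval t ≠ 0 := by
  have hX : (∀ t : ℂ, 0 < t.im → ((Polynomial.X : Polynomial ℂ) ^ m).eval t ≠ 0) ∨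
      (Polynomial.X : Polynomial ℂ) ^ m = 0 :=
    Or.inl fun t ht => by
      rw [Polynomial.eval_pow, Polynomial.eval_X]
      exact pow_ne_zero _ fun h => by rw [h, Complex.zero_im] at ht; exact lt_irrefl _ ht
  rcases iterate_onePlusD_stable_or_zero n hX with h | h
  · rwa [iterate_onePlusD_X_pow] at h
  · exfalso
    rw [iterate_onePlusD_X_pow] at h
    have h1 : (revJensen ℂ n m).eval 1 = 0 := by rw [h, Polynomial.eval_zero]
    rw [← map_revJensen, Polynomial.eval_map, ← Polynomial.aeval_def,
      show (1 : ℂ) = algebraMap ℝ ℂ 1 from (map_one _).symm,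
      Polynomial.aeval_algebraMap_apply_eq_algebraMap_eval, map_eq_zero_iff _ (algebraMap ℝ ℂ).injective,
      eval_revJensen] at h1
    have h2 : (1 : ℝ) ≤ ∑ j ∈ range (n + 1), ((n.choose j : ℕ) : ℝ) * ((m.descFactorial j : ℕ) : ℝ) * 1 ^ (m - j) := by
      have h0 : (0 : ℕ) ∈ range (n + 1) := mem_range.2 (Nat.succ_pos n)
      refine le_trans (by simp) (single_le_sum (f := fun j => ((n.choose j : ℕ) : ℝ) *
        ((m.descFactorial j : ℕ) : ℝ) * 1 ^ (m - j)) (fun j _ => by positivity) h0)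
    linarith

/-- `h_{n,m}(s) > 0` for real `s > 0` (non-negative coefficients, leading term `s^m`).
[cite: BorceaBranden2009, §5.1 proof of Lemma 5.2 ("then necessarily with all negative roots")] -/
theorem eval_revJensen_pos (n m : ℕ) {s : ℝ} (hs : 0 < s) : 0 < (revJensen ℝ n m).eval s := by
  rw [eval_revJensen]
  have h0 : (0 : ℕ) ∈ range (n + 1) := mem_range.2 (Nat.succ_pos n)
  refine lt_of_lt_of_le ?_ (single_le_sum (f := fun j => ((n.choose j : ℕ) : ℝ) *
    ((m.descFactorial j : ℕ) : ℝ) * s ^ (m - j)) (fun j _ => by positivity) h0)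
  simp only [Nat.choose_zero_right, Nat.cast_one, Nat.descFactorial_zero, one_mul, Nat.sub_zero]
  exact pow_pos hs m

end Reversed

/-! ## §3 The Jensen polynomial and Lemma 5.2 -/

section Main

/-- **The Jensen polynomial `g(t) = Σ_{j ≤ n} binom(n,j) (m)_j t^j` has only real zeros `≤ 0`** (indeed
`t^m g(1/t) = h_{n,m}(t)` is stable with positive coefficients). [cite: BorceaBranden2009, §5.1 proof of
Lemma 5.2 ("`g(t) = Σ_j j! binom(n,j) binom(m,j) t^j` is real-rooted (then necessarily with all negative
roots)")] -/
theorem binomialForm_descFactorial_roots (n m : ℕ) (t : ℂ)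
    (ht : (binomialForm n fun k => ((m.descFactorial k : ℕ) : ℂ)).eval t = 0) : t.im = 0 ∧ t.re ≤ 0 := by
  -- `t ≠ 0` since `g(0) = 1`
  have ht0 : t ≠ 0 := by
    rintro rfl
    rw [eval_binomialForm, sum_eq_single 0 (fun k _ hk => by rw [zero_pow hk, mul_zero])
      (fun h => absurd (mem_range.2 (Nat.succ_pos n)) h)] at ht
    simp at ht
  -- `h_{n,m}(1/t) = t^{-m} g(t) = 0`
  set s : ℂ := t⁻¹ with hs
  have hst : s * t = 1 := inv_mul_cancel₀ ht0
  have hhs : (revJensen ℂ n m).eval s = 0 := by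
    have h1 : (revJensen ℂ n m).eval s =
        s ^ m * (binomialForm n fun k => ((m.descFactorial k : ℕ) : ℂ)).eval t := by
      rw [eval_revJensen, eval_binomialForm, mul_sum]
      refine sum_congr rfl fun j _ => ?_
      by_cases hjm : j ≤ m
      · have hpow : s ^ m = s ^ (m - j) * s ^ j := by rw [← pow_add, Nat.sub_add_cancel hjm]
        rw [hpow]
        calc ((n.choose j : ℕ) : ℂ) * ((m.descFactorial j : ℕ) : ℂ) * s ^ (m - j)
            = ((n.choose j : ℕ) : ℂ) * ((m.descFactorial j : ℕ) : ℂ) * s ^ (m - j) * (s * t) ^ j := by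
              rw [hst, one_pow, mul_one]
          _ = s ^ (m - j) * s ^ j * (((n.choose j : ℕ) : ℂ) * ((m.descFactorial j : ℕ) : ℂ) * t ^ j) := by
              rw [mul_pow]; ring
      · rw [Nat.descFactorial_eq_zero_iff_lt.2 (not_le.1 hjm), Nat.cast_zero]
        ring
    rw [h1, ht, mul_zero]
  -- `s` is real (`h` is a real polynomial, stable, zeros come in conjugate pairs) and negative (`h > 0` on `(0,∞)`)
  have hsim : s.im = 0 := by
    refine im_eq_zero_of_eval_eq_zero (f := revJensen ℝ n m) (fun u hu => ?_) ?_
    · rw [map_revJensen]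
      exact revJensen_stable n m u hu
    · rw [map_revJensen]
      exact hhs
  have hsre : s.re < 0 := by
    have hs_eq : s = (s.re : ℂ) := by
      apply Complex.ext <;> simp [hsim]
    rcases lt_trichotomy s.re 0 with h | h | h
    · exact h
    · exfalso
      have : s = 0 := by rw [hs_eq, h, Complex.ofReal_zero]
      rw [this, zero_mul] at hst
      exact zero_ne_one hst
    · exfalso
      have h2 : (revJensen ℂ n m).eval s = (((revJensen ℝ n m).eval s.re : ℝ) : ℂ) := by
        rw [← map_revJensen, hs_eq, Polynomial.eval_map, ← Polynomial.aeval_def, ← Complex.coe_algebraMap,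
          Polynomial.aeval_algebraMap_apply_eq_algebraMap_eval, Complex.coe_algebraMap, Complex.ofReal_re]
      rw [h2, Complex.ofReal_eq_zero] at hhs
      exact (eval_revJensen_pos n m h).ne' hhs
  -- back to `t = 1/s`
  have ht_eq : t = s⁻¹ := by rw [hs, inv_inv]
  have hs_real : s = (s.re : ℂ) := by apply Complex.ext <;> simp [hsim]
  rw [ht_eq, hs_real, ← Complex.ofReal_inv, Complex.ofReal_im, Complex.ofReal_re]
  exact ⟨rfl, (inv_lt_zero.2 hsre).le⟩

/-- **Borcea–Brändén I, Lemma 5.2 (one variable): the falling-factorial multiplier `t^k ↦ (m)_k t^k` preserves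
stability** — for every stable `p ∈ ℂ[t]`, `Σ_k (m)_k a_k t^k` is stable or identically zero.
[cite: BorceaBranden2009, §5.1 Lemma 5.2 (second operator, `n = 1`)] -/
theorem descFactorial_multiplier_stable_or_zero (m : ℕ) {p : Polynomial ℂ}
    (hs : ∀ t : ℂ, 0 < t.im → p.eval t ≠ 0) :
    (∀ t : ℂ, 0 < t.im → (multiplierOp (fun k => ((m.descFactorial k : ℕ) : ℂ)) p).eval t ≠ 0) ∨
      multiplierOp (fun k => ((m.descFactorial k : ℕ) : ℂ)) p = 0 := by
  set n : ℕ := max 1 p.natDegree with hn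
  have hn1 : 0 < n := lt_of_lt_of_le Nat.one_pos (le_max_left _ _)
  exact multiplierOp_stable_or_zero hn1 (binomialForm_descFactorial_roots n m) (le_max_right _ _) hs

end Main

end Literature.Combinatorics.StablePolynomials

end
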